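import Mathlib

/-!
# `GrenetZeon.DualUnipotentThreeHalves` (stmt-ValiantsHypothesis-24318) — P-Q1 kernel port (lead-g2 `Q1-PROOF.md`), Level 1 brick:
# JORDAN FORM OF TYPE `(s,1)`: `Z^s = 0 ≠ Z^{s−1}` in `M_{s+1}(ℂ)` ⇒ `P⁻¹ Z P = A`, the bordered shift `J ⊕ 0`

Experiment cell «val-heavytop-census» (D-0160), engine seat val-htc-eng-1 (g3), kit 0; director R340 (3) (P-Q1 port, eng lineage).  Q1-PROOF §0
starts «after a conjugation taking a generic element to `A := J_{s−1} ⊕ 0`»; every Level-1 brick in the tree (eng-2 g3's ✓ `…HeavyTopBorderOrthogonality`,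
this seat's ✓ `…HeavyTopBorderPathCount`, `…HeavyTopBorderShift`) is stated for that concrete `A` on `Fin (s+1)` through the entry hypothesis
`hA : A i j = if j = i+1 ∧ j < s then 1 else 0`.  This file supplies the conjugation, by the elementary cyclic-vector argument (no appeal to the
general Jordan canonical form ✓ `Literature…JordanCanonicalForm`, whose block bookkeeping would have to be re-indexed anyway):

* `linearIndependent_cyclic` — `Z^s = 0`, `Z^{s−1}v ≠ 0` ⇒ `Z^{s−1}v, …, Zv, v` independent; `mulVec_mem_span_cyclic` — their span `U` is `Z`-stable.
* ★ `exists_mulVec_eq_zero_not_mem_span_cyclic` — a SECOND chain: some `x' ∈ ker Z` outside `U` (`dim U = s < s+1`; for `x ∉ U`, `Zx = y + c x` with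
  `y ∈ U`, `Z^k x ≡ c^k x (mod U)` and `Z^s = 0` give `c = 0`; the `v`-coefficient of `y` dies under `Z^{s−1}`, so `y = Z y'`, `y' ∈ U`; `x' = x − y'`).
* ★★ `exists_isUnit_conj_eq_shift` — `∃ P, IsUnit P ∧ P⁻¹ Z P = of (fun i j => if j = i+1 ∧ j < s then 1 else 0)` (columns of `P`: the chain and `x'`;
  `IsUnit` via `Module.Basis.toMatrix_mul_toMatrix_flip`); `exists_isUnit_conj_apply_eq_shift` — the entry form matching `hA`.

Pure linear algebra; nothing here is a statement about nilpotent subspaces, ι(7), (5,7), R2 or 24318 (OPEN / not moved); VP ≠ VNP NOT proved.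
`--supports stmt-ValiantsHypothesis-24318 --as helper`.  No definitions, no named facts.
[lead-g2 `Q1-PROOF.md` §0 = crux `CENSUS-Q1-PROOF.md`; eng-2 g3 INBOX 02:28:12Z (conventions); this seat]
-/

set_option linter.dupNamespace false
set_option autoImplicit false

namespace Summit.ValiantsHypothesis.ValiantsHypothesis.Theorems.GrenetZeon.HeavyTopJordanShift

open Matrix
open scoped BigOperators

variable {s : ℕ}

/-! ## §1 The cyclic vectors `Z^{s−1−i} v` -/

/-- Exponent bookkeeping: `Z^a (Z^b x) = Z^{a+b} x`. -/
theorem pow_mulVec_pow_mulVec (Z : Matrix (Fin (s + 1)) (Fin (s + 1)) ℂ) (a b : ℕ) (x : Fin (s + 1) → ℂ) :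
    Z ^ a *ᵥ (Z ^ b *ᵥ x) = Z ^ (a + b) *ᵥ x := by
  rw [Matrix.mulVec_mulVec, ← pow_add]

/-- **The cyclic vectors are independent**: if `Z^s = 0` and `Z^{s−1} v ≠ 0` then `Z^{s−1}v, Z^{s−2}v, …, v` are linearly independent
(apply `Z^{i₀}` to a relation: it kills the longer vectors, and the shorter ones have zero coefficient by downward induction). [folklore] -/
theorem linearIndependent_cyclic (Z : Matrix (Fin (s + 1)) (Fin (s + 1)) ℂ) (v : Fin (s + 1) → ℂ) (hZs : Z ^ s = 0)
    (hv : Z ^ (s - 1) *ᵥ v ≠ 0) : LinearIndependent ℂ (fun i : Fin s => Z ^ (s - 1 - (i : ℕ)) *ᵥ v) := by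
  rw [Fintype.linearIndependent_iff]
  intro g hg
  suffices H : ∀ n : ℕ, ∀ i : Fin s, (i : ℕ) + n = s - 1 → g i = 0 from fun i => H (s - 1 - i) i (by omega)
  intro n
  induction n using Nat.strong_induction_on with
  | _ n ih =>
    intro i₀ hi₀
    have h := congrArg (Matrix.mulVecLin (Z ^ (i₀ : ℕ))) hg
    rw [map_sum, map_zero] at h
    simp only [map_smul, Matrix.mulVecLin_apply, pow_mulVec_pow_mulVec] at h
    rw [Finset.sum_eq_single i₀] at h
    · rw [show (i₀ : ℕ) + (s - 1 - (i₀ : ℕ)) = s - 1 by omega] at h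
      exact (smul_eq_zero.1 h).resolve_right hv
    · intro i _ hi
      by_cases hlt : (i : ℕ) < i₀
      · rw [pow_eq_zero_of_le (by omega : s ≤ (i₀ : ℕ) + (s - 1 - (i : ℕ))) hZs, Matrix.zero_mulVec, smul_zero]
      · have hne : (i : ℕ) ≠ i₀ := fun e => hi (Fin.ext e)
        rw [ih (s - 1 - i) (by omega) i (by omega), zero_smul]
    · intro h'
      exact absurd (Finset.mem_univ _) h'

/-- **The cyclic span is `Z`-stable.** [folklore] -/
theorem mulVec_mem_span_cyclic (Z : Matrix (Fin (s + 1)) (Fin (s + 1)) ℂ) (v : Fin (s + 1) → ℂ) (hZs : Z ^ s = 0)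
    {y : Fin (s + 1) → ℂ} (hy : y ∈ Submodule.span ℂ (Set.range fun i : Fin s => Z ^ (s - 1 - (i : ℕ)) *ᵥ v)) :
    Z *ᵥ y ∈ Submodule.span ℂ (Set.range fun i : Fin s => Z ^ (s - 1 - (i : ℕ)) *ᵥ v) := by
  refine Submodule.span_induction (p := fun y _ => Z *ᵥ y ∈ Submodule.span ℂ (Set.range fun i : Fin s => Z ^ (s - 1 - (i : ℕ)) *ᵥ v))
    ?_ ?_ ?_ ?_ hy
  · rintro _ ⟨i, rfl⟩
    have h1 : Z *ᵥ (Z ^ (s - 1 - (i : ℕ)) *ᵥ v) = Z ^ (s - (i : ℕ)) *ᵥ v := by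
      rw [Matrix.mulVec_mulVec, ← pow_succ', show s - 1 - (i : ℕ) + 1 = s - (i : ℕ) by omega]
    rw [h1]
    by_cases hi : (i : ℕ) = 0
    · rw [hi, Nat.sub_zero, hZs, Matrix.zero_mulVec]
      exact Submodule.zero_mem _
    · refine Submodule.subset_span ⟨⟨(i : ℕ) - 1, by omega⟩, ?_⟩
      simp only
      rw [show s - 1 - ((i : ℕ) - 1) = s - (i : ℕ) by omega]
  · rw [Matrix.mulVec_zero]
    exact Submodule.zero_mem _
  · intro x y _ _ hx hy
    rw [Matrix.mulVec_add]
    exact Submodule.add_mem _ hx hy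
  · intro a x _ hx
    rw [Matrix.mulVec_smul]
    exact Submodule.smul_mem _ a hx

/-! ## §2 A kernel vector outside the cyclic span -/

/-- **A second Jordan chain.**  If `Z^s = 0` and `Z^{s−1}v ≠ 0` in dimension `s + 1`, some `x' ∈ ker Z` lies outside the cyclic span
`U = ⟨Z^{s−1}v, …, v⟩` (so the Jordan type of `Z` is `(s, 1)`).  Proof: `dim U = s`, pick `x ∉ U`; `U + ℂx` is everything, so `Zx = y + c x`
with `y ∈ U`; `Z^k x ≡ c^k x (mod U)` and `Z^s = 0` force `c = 0`; the `v`-coefficient of `y = Zx` vanishes (apply `Z^{s−1}`), so `y = Z y'`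
with `y' ∈ U`, and `x' := x − y'`. [folklore] -/
theorem exists_mulVec_eq_zero_not_mem_span_cyclic (hs : 1 ≤ s) (Z : Matrix (Fin (s + 1)) (Fin (s + 1)) ℂ) (v : Fin (s + 1) → ℂ)
    (hZs : Z ^ s = 0) (hv : Z ^ (s - 1) *ᵥ v ≠ 0) :
    ∃ x' : Fin (s + 1) → ℂ, Z *ᵥ x' = 0 ∧ x' ∉ Submodule.span ℂ (Set.range fun i : Fin s => Z ^ (s - 1 - (i : ℕ)) *ᵥ v) := by
  set c : Fin s → (Fin (s + 1) → ℂ) := fun i => Z ^ (s - 1 - (i : ℕ)) *ᵥ v with hc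
  set U : Submodule ℂ (Fin (s + 1) → ℂ) := Submodule.span ℂ (Set.range c) with hU
  have hli : LinearIndependent ℂ c := linearIndependent_cyclic Z v hZs hv
  have hUZ : ∀ y ∈ U, Z *ᵥ y ∈ U := fun y hy => mulVec_mem_span_cyclic Z v hZs hy
  have hfin : Module.finrank ℂ U = s := by
    rw [hU, finrank_span_eq_card hli, Fintype.card_fin]
  -- a vector outside `U`
  have hUtop : U ≠ ⊤ := by
    intro h
    have h2 := hfin
    rw [h, finrank_top, Module.finrank_fintype_fun_eq_card, Fintype.card_fin] at h2
    omega
  obtain ⟨x, -, hxU⟩ := SetLike.exists_of_lt (lt_top_iff_ne_top.2 hUtop)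
  -- `U + ℂx` is the whole space
  have hsup : U ⊔ Submodule.span ℂ {x} = ⊤ := by
    apply Submodule.eq_top_of_finrank_eq
    rw [Module.finrank_fintype_fun_eq_card, Fintype.card_fin]
    have hlt : U < U ⊔ Submodule.span ℂ {x} := by
      refine lt_of_le_of_ne le_sup_left fun h => hxU ?_
      rw [h]
      exact Submodule.mem_sup_right (Submodule.mem_span_singleton_self x)
    have h1 := Submodule.finrank_lt_finrank_of_lt hlt
    have h2 := Submodule.finrank_le (U ⊔ Submodule.span ℂ {x})
    rw [Module.finrank_fintype_fun_eq_card, Fintype.card_fin] at h2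
    omega
  -- `Z x = y + c₀ x`
  have hZx : Z *ᵥ x ∈ U ⊔ Submodule.span ℂ {x} := by
    rw [hsup]
    exact Submodule.mem_top
  obtain ⟨y, hyU, z, hz, hyz⟩ := Submodule.mem_sup.1 hZx
  obtain ⟨c₀, rfl⟩ := Submodule.mem_span_singleton.1 hz
  -- `Z^k x − c₀^k x ∈ U` for every `k`
  have hq : ∀ k : ℕ, Z ^ k *ᵥ x - c₀ ^ k • x ∈ U := by
    intro k
    induction k with
    | zero =>
      rw [pow_zero, pow_zero, Matrix.one_mulVec, one_smul, sub_self]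
      exact U.zero_mem
    | succ k ih =>
      have e1 : Z ^ (k + 1) *ᵥ x = Z *ᵥ (Z ^ k *ᵥ x) := by rw [Matrix.mulVec_mulVec, ← pow_succ']
      have e2 : Z *ᵥ (Z ^ k *ᵥ x - c₀ ^ k • x) = Z *ᵥ (Z ^ k *ᵥ x) - c₀ ^ k • (y + c₀ • x) := by
        rw [Matrix.mulVec_sub, Matrix.mulVec_smul, hyz]
      have e : Z ^ (k + 1) *ᵥ x - c₀ ^ (k + 1) • x = Z *ᵥ (Z ^ k *ᵥ x - c₀ ^ k • x) + c₀ ^ k • y := by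
        rw [e1, e2, pow_succ, mul_smul, smul_add]
        abel
      rw [e]
      exact U.add_mem (hUZ _ ih) (U.smul_mem _ hyU)
  -- hence `c₀ = 0`
  have hc₀ : c₀ = 0 := by
    by_contra hne
    apply hxU
    have hsx : c₀ ^ s • x ∈ U := by
      have h := hq s
      rw [hZs, Matrix.zero_mulVec, zero_sub] at h
      exact (neg_mem_iff).1 h
    exact (Submodule.smul_mem_iff U (pow_ne_zero s hne)).1 hsx
  have hZxy : Z *ᵥ x = y := by rw [← hyz, hc₀, zero_smul, add_zero]
  -- coordinates of `y` on the cyclic vectors; the coefficient of `v` vanishes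
  obtain ⟨d, hd⟩ := (Submodule.mem_span_range_iff_exists_fun ℂ).1 hyU
  have hds : d ⟨s - 1, by omega⟩ = 0 := by
    have h := congrArg (Matrix.mulVecLin (Z ^ (s - 1))) hd
    rw [map_sum, Matrix.mulVecLin_apply, ← hZxy, Matrix.mulVec_mulVec, ← pow_succ,
      show s - 1 + 1 = s by omega, hZs, Matrix.zero_mulVec] at h
    simp only [map_smul, Matrix.mulVecLin_apply, hc, pow_mulVec_pow_mulVec] at h
    rw [Finset.sum_eq_single ⟨s - 1, by omega⟩] at h
    · rw [show s - 1 + (s - 1 - (s - 1)) = s - 1 by omega] at h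
      exact (smul_eq_zero.1 h).resolve_right hv
    · intro i _ hi
      have hne : (i : ℕ) ≠ s - 1 := fun e => hi (Fin.ext e)
      rw [pow_eq_zero_of_le (by omega : s ≤ s - 1 + (s - 1 - (i : ℕ))) hZs, Matrix.zero_mulVec, smul_zero]
    · intro h'
      exact absurd (Finset.mem_univ _) h'
  -- `y = Z y'` with `y' ∈ U`
  set y' : Fin (s + 1) → ℂ := ∑ i : Fin s, d i • (if (i : ℕ) + 1 < s then Z ^ (s - 1 - ((i : ℕ) + 1)) *ᵥ v else 0) with hy'
  have hy'U : y' ∈ U := by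
    refine U.sum_mem fun i _ => U.smul_mem _ ?_
    split_ifs with h
    · exact Submodule.subset_span ⟨⟨(i : ℕ) + 1, h⟩, rfl⟩
    · exact U.zero_mem
  have hZy' : Z *ᵥ y' = y := by
    have h1 : Z *ᵥ y' = ∑ i : Fin s, d i • (if (i : ℕ) + 1 < s then Z ^ (s - 1 - (i : ℕ)) *ᵥ v else 0) := by
      have := map_sum (Matrix.mulVecLin Z) (fun i : Fin s => d i • (if (i : ℕ) + 1 < s then Z ^ (s - 1 - ((i : ℕ) + 1)) *ᵥ v else 0))
        Finset.univ
      rw [Matrix.mulVecLin_apply] at this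
      rw [hy', this]
      refine Finset.sum_congr rfl fun i _ => ?_
      rw [map_smul, Matrix.mulVecLin_apply]
      congr 1
      split_ifs with h
      · rw [Matrix.mulVec_mulVec, ← pow_succ', show s - 1 - ((i : ℕ) + 1) + 1 = s - 1 - (i : ℕ) by omega]
      · rw [Matrix.mulVec_zero]
    rw [h1, ← hd]
    refine Finset.sum_congr rfl fun i _ => ?_
    split_ifs with h
    · rfl
    · have hi : i = ⟨s - 1, by omega⟩ := Fin.ext (by have := i.isLt; simp; omega)
      rw [hi, hds, zero_smul, zero_smul]
  refine ⟨x - y', ?_, fun h => hxU ?_⟩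
  · rw [Matrix.mulVec_sub, hZy', hZxy, sub_self]
  · have : x = (x - y') + y' := by abel
    rw [this]
    exact U.add_mem h hy'U

/-! ## §3 The conjugation to the bordered shift -/

/-- **JORDAN FORM OF TYPE `(s,1)`.**  If `Z ∈ M_{s+1}(ℂ)` satisfies `Z^s = 0` and `Z^{s−1} ≠ 0` (`s ≥ 1`), then `Z` is conjugate to the bordered
shift: `P⁻¹ Z P = A` with `A_{ij} = [j = i + 1 ∧ j < s]` (`A e_{i+1} = e_i` on `e_0,…,e_{s−1}`, `A e_0 = A e_∞ = 0`), for an invertible `P` whose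
columns are `Z^{s−1}v, …, Zv, v` and a kernel vector `x' ∉ ⟨Z^{s−1}v, …, v⟩`.  This is the normalisation «conjugate a generic element of `V`
(generic type `(s−1,1)`, lead's indexing) to `J_{s−1} ⊕ 0`» of Q1-PROOF §0 in the conventions of the Level-1 bricks (`hA` hypothesis of
✓ `…HeavyTopBorderPathCount`, ✓ `…HeavyTopBorderShift`). [folklore (Jordan); this file] -/
theorem exists_isUnit_conj_eq_shift (hs : 1 ≤ s) (Z : Matrix (Fin (s + 1)) (Fin (s + 1)) ℂ) (hZs : Z ^ s = 0)
    (hZ : Z ^ (s - 1) ≠ 0) :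
    ∃ P : Matrix (Fin (s + 1)) (Fin (s + 1)) ℂ, IsUnit P ∧
      P⁻¹ * Z * P = Matrix.of fun i j : Fin (s + 1) => if (j : ℕ) = i + 1 ∧ (j : ℕ) < s then (1 : ℂ) else 0 := by
  classical
  -- a vector with `Z^{s-1} v ≠ 0`
  obtain ⟨v, hv⟩ : ∃ v : Fin (s + 1) → ℂ, Z ^ (s - 1) *ᵥ v ≠ 0 := by
    by_contra h
    push Not at h
    apply hZ
    ext i j
    have := congrFun (h (Pi.single j 1)) i
    simpa [Matrix.mulVec, dotProduct, Pi.single_apply] using this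
  obtain ⟨x', hx'0, hx'U⟩ := exists_mulVec_eq_zero_not_mem_span_cyclic hs Z v hZs hv
  set c : Fin s → (Fin (s + 1) → ℂ) := fun i => Z ^ (s - 1 - (i : ℕ)) *ᵥ v with hc
  have hli : LinearIndependent ℂ c := linearIndependent_cyclic Z v hZs hv
  -- the full family: cyclic vectors, then the kernel vector
  let b : Fin (s + 1) → (Fin (s + 1) → ℂ) := fun j => if h : (j : ℕ) < s then c ⟨j, h⟩ else x'
  have hb_lt : ∀ (j : Fin (s + 1)) (h : (j : ℕ) < s), b j = c ⟨j, h⟩ := fun j h => by simp only [b, dif_pos h]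
  have hb_last : b (Fin.last s) = x' := by simp [b]
  have hbli : LinearIndependent ℂ b := by
    rw [Fintype.linearIndependent_iff]
    intro g hg
    rw [Fin.sum_univ_castSucc, hb_last] at hg
    have hcs : ∀ i : Fin s, b i.castSucc = c i := fun i => by
      rw [hb_lt i.castSucc (by simp)]
      exact congrArg c (Fin.ext (by simp))
    simp only [hcs] at hg
    have hsumU : ∑ i : Fin s, g i.castSucc • c i ∈ Submodule.span ℂ (Set.range c) :=
      Submodule.sum_mem _ fun i _ => Submodule.smul_mem _ _ (Submodule.subset_span ⟨i, rfl⟩)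
    have hglast : g (Fin.last s) = 0 := by
      by_contra hne
      apply hx'U
      have h1 : g (Fin.last s) • x' = -(∑ i : Fin s, g i.castSucc • c i) := eq_neg_of_add_eq_zero_right hg
      have h2 : g (Fin.last s) • x' ∈ Submodule.span ℂ (Set.range c) := by
        rw [h1]
        exact Submodule.neg_mem _ hsumU
      exact (Submodule.smul_mem_iff _ hne).1 h2
    rw [hglast, zero_smul, add_zero] at hg
    have hgc := (Fintype.linearIndependent_iff.1 hli) (fun i => g i.castSucc) hg
    intro j
    by_cases h : (j : ℕ) < s
    · have : j = (⟨j, h⟩ : Fin s).castSucc := Fin.ext rfl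
      rw [this]
      exact hgc _
    · have : j = Fin.last s := Fin.ext (by have := j.isLt; simp; omega)
      rw [this]
      exact hglast
  -- the basis and the change-of-basis matrix
  let bB : Module.Basis (Fin (s + 1)) ℂ (Fin (s + 1) → ℂ) :=
    basisOfLinearIndependentOfCardEqFinrank hbli (by rw [Module.finrank_fintype_fun_eq_card])
  have hbB : ∀ j, bB j = b j := fun j =>
    congrFun (coe_basisOfLinearIndependentOfCardEqFinrank hbli (by rw [Module.finrank_fintype_fun_eq_card])) j
  set P : Matrix (Fin (s + 1)) (Fin (s + 1)) ℂ := (Pi.basisFun ℂ (Fin (s + 1))).toMatrix bB with hPdef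
  have hP : ∀ i j, P i j = b j i := fun i j => by
    rw [hPdef, Module.Basis.toMatrix_apply, Pi.basisFun_repr, hbB]
  have hS : P * bB.toMatrix (Pi.basisFun ℂ (Fin (s + 1))) = 1 := Module.Basis.toMatrix_mul_toMatrix_flip _ _
  have hS' : bB.toMatrix (Pi.basisFun ℂ (Fin (s + 1))) * P = 1 := Module.Basis.toMatrix_mul_toMatrix_flip _ _
  have hPunit : IsUnit P := ⟨⟨P, _, hS, hS'⟩, rfl⟩
  -- `Z b_j = b_{j-1}` (`1 ≤ j < s`), `Z b_0 = 0`, `Z b_∞ = 0`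
  have hZb : ∀ j : Fin (s + 1), Z *ᵥ b j =
      if h : 1 ≤ (j : ℕ) ∧ (j : ℕ) < s then b ⟨(j : ℕ) - 1, by omega⟩ else 0 := by
    intro j
    by_cases hj : (j : ℕ) < s
    · rw [hb_lt j hj]
      by_cases hj1 : 1 ≤ (j : ℕ)
      · rw [dif_pos ⟨hj1, hj⟩, hb_lt _ (by simp; omega)]
        simp only [hc]
        rw [Matrix.mulVec_mulVec, ← pow_succ', show s - 1 - (j : ℕ) + 1 = s - 1 - ((j : ℕ) - 1) by omega]
      · rw [dif_neg (by omega)]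
        simp only [hc]
        rw [Matrix.mulVec_mulVec, ← pow_succ', show s - 1 - (j : ℕ) + 1 = s by omega, hZs, Matrix.zero_mulVec]
    · have : j = Fin.last s := Fin.ext (by have := j.isLt; simp; omega)
      rw [this, hb_last, hx'0, dif_neg (by simp)]
  -- `Z P = P A`
  have hZP : Z * P = P * Matrix.of fun i j : Fin (s + 1) => if (j : ℕ) = i + 1 ∧ (j : ℕ) < s then (1 : ℂ) else 0 := by
    ext r j
    have lhs : (Z * P) r j = (Z *ᵥ b j) r := by
      simp only [Matrix.mul_apply, Matrix.mulVec, dotProduct, hP]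
    rw [lhs, hZb j, Matrix.mul_apply]
    by_cases h : 1 ≤ (j : ℕ) ∧ (j : ℕ) < s
    · rw [dif_pos h, Finset.sum_eq_single ⟨(j : ℕ) - 1, by omega⟩]
      · rw [hP, Matrix.of_apply, if_pos (by simp; omega), mul_one]
      · intro k _ hk
        have hne : (k : ℕ) ≠ j - 1 := fun e => hk (Fin.ext e)
        rw [Matrix.of_apply, if_neg (by omega), mul_zero]
      · intro h'
        exact absurd (Finset.mem_univ _) h'
    · rw [dif_neg h, Pi.zero_apply]
      symm
      refine Finset.sum_eq_zero fun k _ => ?_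
      rw [Matrix.of_apply, if_neg (by omega), mul_zero]
  refine ⟨P, hPunit, ?_⟩
  have hPdet : IsUnit P.det := (Matrix.isUnit_iff_isUnit_det P).1 hPunit
  rw [Matrix.mul_assoc, hZP, ← Matrix.mul_assoc, Matrix.nonsing_inv_mul P hPdet, Matrix.one_mul]

/-- Entry form of ✓ `exists_isUnit_conj_eq_shift`, matching the hypothesis `hA` of the Level-1 bricks. [this file] -/
theorem exists_isUnit_conj_apply_eq_shift (hs : 1 ≤ s) (Z : Matrix (Fin (s + 1)) (Fin (s + 1)) ℂ) (hZs : Z ^ s = 0)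
    (hZ : Z ^ (s - 1) ≠ 0) :
    ∃ P : Matrix (Fin (s + 1)) (Fin (s + 1)) ℂ, IsUnit P ∧
      ∀ i j : Fin (s + 1), (P⁻¹ * Z * P) i j = if (j : ℕ) = i + 1 ∧ (j : ℕ) < s then (1 : ℂ) else 0 := by
  obtain ⟨P, hP, h⟩ := exists_isUnit_conj_eq_shift hs Z hZs hZ
  exact ⟨P, hP, fun i j => by rw [h, Matrix.of_apply]⟩

end Summit.ValiantsHypothesis.ValiantsHypothesis.Theorems.GrenetZeon.HeavyTopJordanShift
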